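import Summits.ValiantsHypothesis.ValiantsHypothesis.Theorems.BarrierLeverPartitionMinorsHitByVPHiddenStatesSymbolic

/-!
# Route BarrierLever — item `PartitionMinorsHitByVP` (stmt-ValiantsHypothesis-19717), line `hidden_states`:
# REFINING THE PIECE PARTITION NEVER HURTS (generic goodness is monotone under splitting pieces)

Helper file (`--supports stmt-ValiantsHypothesis-19717`; cell valiant-natproofs, rung V4, 𝒟-side door (c); prover seat val-np-p6 gen 9).
Definition-free. Closes NO item.

`SymbJoin.symGood_refine`: let `e' : Fin r → Fin m' × Finset (Fin K)` be a join configuration and `f : Fin m' → Fin m` any map of piece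
labels; the COARSENED configuration `e = (f ∘ fst, snd) ∘ e'` puts the columns of all pieces in a fibre of `f` into one piece (same hidden
sets). If the coarse configuration is generically good for `u`, so is the fine one. Proof: renaming the indeterminates
`X_{(p',o,a)} ↦ X_{(f p',o,a)}` (an algebra endomorphism) maps `symDet u e'` to `symDet u e`; a polynomial with a nonzero image is nonzero.

CONSEQUENCES for the design question of the line (memos HOME/val-np-p6/g8, g9). (1) Splitting a piece into several pieces with the same
members (in particular PEELING a ball `B_t([n]) = B_t([n−1]) ⊔ (n−1) * B_{t−1}([n−1])` into separate pieces) can only enlarge the set of row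
families a design is good for; merging pieces can only shrink it. So among legal designs with the same multiset of hidden sets the most
refined ones dominate, the bare ball is the worst, and the piece budget `m ≤ 2h` is the only force towards coarse designs — consistent with
every census of the cell (bare balls fail, full peels never did). (2) Universality statements need only be proved for the coarsest member of
a refinement chain one can afford, and refuted for the finest.

WHAT THIS IS NOT: nothing about legality of refinements (each piece must itself be a threshold family, jointly thresholded); item 19717
OPEN; nothing on crux 14610 or VP ≠ VNP.
-/

set_option linter.dupNamespace false

namespace Summit.ValiantsHypothesis.ValiantsHypothesis.Theorems.BarrierLever.HiddenStates

open Finset Matrix MvPolynomial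

noncomputable section

namespace SymbJoin

variable {h m K r : ℕ}

/-- **Refining the piece partition never hurts.** If the configuration obtained by relabelling pieces along `f : Fin m' → Fin m`
(merging the pieces in each fibre) is generically good, then the original configuration is generically good. -/
theorem symGood_refine {m' : ℕ} (u : Fin r → Finset (Fin h)) (e' : Fin r → Fin m' × Finset (Fin K)) (f : Fin m' → Fin m)
    (hG : symDet u (fun k => (f (e' k).1, (e' k).2)) ≠ 0) : symDet u e' ≠ 0 := by
  classical
  intro hD
  apply hG
  set Φ : MvPolynomial (Var m' K h) ℂ →ₐ[ℂ] MvPolynomial (Var m K h) ℂ :=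
    MvPolynomial.rename fun v : Var m' K h => ((f v.1, v.2) : Var m K h) with hΦ
  have hpt : ∀ k a, Φ (symPoint e' k a) = symPoint (fun k => (f (e' k).1, (e' k).2)) k a := by
    intro k a
    simp [hΦ, symPoint, MvPolynomial.rename_X, map_add, map_sum]
  have hmat : Φ.toRingHom.mapMatrix (symMat u e') = symMat u (fun k => (f (e' k).1, (e' k).2)) := by
    ext i k
    simp only [RingHom.mapMatrix_apply, Matrix.map_apply, symMat, Matrix.of_apply, AlgHom.toRingHom_eq_coe,
      RingHom.coe_coe, map_prod, hpt]
  rw [symDet, ← hmat, ← RingHom.map_det, show (symMat u e').det = symDet u e' from rfl, hD, map_zero]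

/-- The same in the numeric language of the line's stubs: a good table for the coarse design yields a good table for the fine one. -/
theorem exists_table_refine {m' : ℕ} (u : Fin r → Finset (Fin h)) (e' : Fin r → Fin m' × Finset (Fin K)) (f : Fin m' → Fin m)
    (hG : ∃ tx : Fin m → Option (Fin K) → Fin h → ℂ,
      (Matrix.of fun i k : Fin r =>
        ∏ a ∈ u i, (tx (f (e' k).1) none a + ∑ q ∈ (e' k).2, tx (f (e' k).1) (some q) a)).det ≠ 0) :
    ∃ tx : Fin m' → Option (Fin K) → Fin h → ℂ,
      (Matrix.of fun i k : Fin r =>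
        ∏ a ∈ u i, (tx (e' k).1 none a + ∑ q ∈ (e' k).2, tx (e' k).1 (some q) a)).det ≠ 0 := by
  obtain ⟨tx, htx⟩ := hG
  exact exists_table_of_symGood u e' (symGood_refine u e' f
    (symGood_of_table u (fun k => (f (e' k).1, (e' k).2)) tx htx))

end SymbJoin

end

end Summit.ValiantsHypothesis.ValiantsHypothesis.Theorems.BarrierLever.HiddenStates
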